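import Mathlib
import Literature.NumberTheory.LFunctions.SuzukiWeilHilbertSpace
import Literature.NumberTheory.LFunctions.SuzukiWeilModelSpace
import Literature.NumberTheory.LFunctions.SuzukiWeilKernelProofs
import Literature.NumberTheory.LFunctions.SuzukiWeilKernelBoundProofs
import Literature.NumberTheory.LFunctions.SuzukiWeilChainBoundaryProofs
import Literature.NumberTheory.LFunctions.SuzukiWeilChainSpaceProofs
import Literature.NumberTheory.LFunctions.LagariasXiStructureFunctionProofs
import Literature.Analysis.DeBrangesSpaces.UpperHalfPlaneZeroExtension
import Literature.Analysis.FunctionSpaces.L2ProductHilbertBasis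
import HarnessLib

/-!
# `E_ξ𝖥(V(0)) ⊆ 𝓗(E_ξ)` under RH — the second half of CJM Lemma 5.1 (ii); `Suzuki2025_lemma51_holds`

LINE 1 — LABEL: RH-FREE corpus theorems (§A–§D, §E (dB2)) and RH-CONSEQUENCE proofs (explicit
binder `RiemannHypothesis →`, §E) about the RH-FREE objects of the cell rh-crit/dbl (M. Suzuki,
*On the Hilbert space derived from the Weil distribution*, Canad. J. Math. 2025 = arXiv:2301.00421v3,
Lemma 5.1 and the proof of Thm. 5.7), discharging the cell's RH-CONSEQUENCE fact
`Suzuki2025_lemma51` (dbl-t10, `SuzukiWeilHilbertSpace.lean`). bears_on: B-C/B-P (LADDER-RH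
COLUMN 6 DBR) as corpus infrastructure under the RH-EQUIVALENT·DERIVED residual `IsolatedV0`.
WHAT THIS IS NOT: a printed RH-CONSEQUENCE structure lemma ("under RH, `𝓗(E_ξ) = E_ξ𝖥(V(0))`")
becomes a tree theorem WITH its RH binder; nothing here bears on the truth of RH.

## What is proved

* §A (RH-FREE) `suzukiFourierL2_suzukiK_ae_eq` — `𝖥(𝖪ψ) = Θ_ξ·conj(𝖥ψ)` a.e. on `ℝ` in Suzuki's
  normalisation (CJM (5.1) "`(𝖥𝖪ψ)(z) = Θ(z)(𝖥ψ)♯(z)`"); `sharp_ofReal_ae_eq` — for `Φ` entire with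
  `Φ = E_ξf̂` on `ℂ₊`, `f ∈ V(0)`: `Φ♯ = E_ξ·𝖥(𝖪f)` a.e. on `ℝ`.
* §B (RH-FREE) `norm_sq_cauchyVec` (`‖e_w‖² = 1/(2 Im w)`), `norm_upperHalfHat_le`
  (`|ĝ(z)| ≤ ‖g‖/√(2 Im z)` for every `g ∈ L²(ℝ)`).
* §C (folklore plumbing) uniform continuity on a box; `∫_a^b |F| ≤ √(b−a)‖F‖` for `F ∈ L²(ℝ)`.
* §D (RH-FREE) **the gluing identity** `sharp_eq_lagariasE_mul_upperHalfHat_suzukiK`: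
  `Φ♯ = E_ξ·(𝖪f)^` on `ℂ₊` — i.e. `Φ(z) = E_ξ♯(z)·conj((𝖪f)^(z̄))` on the LOWER half-plane — by the
  boundary-uniqueness theorem `DeBrangesSpaces.eq_zero_of_trace_tendsto_zero` applied to the defect
  `D = Φ♯ − E_ξ(𝖪f)^` (holomorphic on `ℂ₊`, majorant `C(1 + y^{−1/2})`, traces `→ 0` in `L¹_loc`
  since `Φ♯(x+iy) → Φ♯(x)` and `E(x+iy) → E(x)` uniformly on `[a,b]`, `(𝖪f)^(·+iy) → 𝖥𝖪f` in
  `L²(ℝ)` by the cell's `norm_suzukiFourierL2_indicator_mul_exp_sub_lt`, and `Φ♯ = E·𝖥𝖪f` a.e.).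
* §E `sharp_mem_suzukiChainSpace` — axiom (dB2) of CJM Thm. 5.7 for every `t ≥ 0`, RH-FREE;
  `norm_sq_le_kernelDiag` — under RH, `|Φ(z)|² ≤ 2π‖f‖²K(z,z)` on BOTH half-planes (the cell's
  `SuzukiKernelBound.norm_sq_lagariasE_mul_upperHalfHat_le` on `ℂ₊`, transported to `ℂ₋` by the
  gluing, `‖𝖪f‖ = ‖f‖`, `K(z̄,z̄) = K(z,z)`); `mem_deBrangesSpace_of_mem_suzukiChainSpace_zero`,
  `suzukiChainSpace_zero_subset_deBrangesSpace`; with the cell's `⊇`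
  (`deBrangesSpace_subset_suzukiChainSpace_zero`, dbl-iso g3) **`suzukiChainSpace_zero_eq_deBrangesSpace`**
  and **`Suzuki2025_lemma51_holds : Suzuki2025_lemma51`**.

## References
* M. Suzuki, Canad. J. Math. 2025 = arXiv:2301.00421v3, Lemma 5.1 p. 13 (TeX l.1464–1496), Thm. 5.7
  p. 16 (TeX l.1844–1897), §2.2–2.4. [Suzuki2025WeilHilbertSpace]
* W. Rudin, *Real and complex analysis*, Thm. 16.8 (Painlevé/Morera), Thm. 19.2. [Rudin1987]
-/

noncomputable section

open MeasureTheory Complex Filter Set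
open scoped ComplexConjugate Topology Real ENNReal InnerProductSpace

namespace Literature.NumberTheory.LFunctions

open Literature.Analysis.DeBrangesSpaces Literature.Analysis.Fourier
  Literature.Analysis.FunctionSpaces

namespace SuzukiChainInclusion

/-! ## A. RH-FREE identities on the real line -/

/-- **`𝖥(𝖪ψ) = Θ_ξ · conj(𝖥ψ)` a.e. on `ℝ`** in Suzuki's own normalisation (`𝖥 = suzukiFourierL2`):
the boundary identity "(𝖥𝖪ψ)(z) = Θ(z)(𝖥ψ)♯(z)" of CJM (5.1), transported from the cell's Mathlib-side
`fourierInv_suzukiK_ae_eq` by the dilation `u ↦ u/2π`. RH-FREE.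
[cite: Suzuki2025WeilHilbertSpace, CJM Lemma 5.1 proof p. 13 (TeX l.1480–1482) and eq. (5.1)] -/
theorem suzukiFourierL2_suzukiK_ae_eq (ψ : Lp ℂ 2 (volume : Measure ℝ)) :
    (suzukiFourierL2 (suzukiK ψ) : ℝ → ℂ) =ᵐ[volume]
      fun u : ℝ ↦ lagariasTheta (u : ℂ) * conj ((suzukiFourierL2 ψ : ℝ → ℂ) u) := by
  have hc : (2 * Real.pi)⁻¹ ≠ 0 := inv_ne_zero Real.two_pi_pos.ne'
  have hq := (measurePreserving_mul_left hc).quasiMeasurePreserving.mono_right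
    Measure.smul_absolutelyContinuous
  filter_upwards [coeFn_suzukiFourierL2 (suzukiK ψ), coeFn_suzukiFourierL2 ψ,
    hq.ae (fourierInv_suzukiK_ae_eq ψ)] with u e1 e2 e3
  rw [e1, e3, e2]
  congr 2
  have hπ : (Real.pi : ℂ) ≠ 0 := Complex.ofReal_ne_zero.2 Real.pi_ne_zero
  push_cast
  field_simp

/-- **Boundary identity of the chain**: if `Φ` is entire with `Φ = E_ξ·f̂` on `ℂ₊` for some
`f ∈ V(0)`, then `Φ♯(x) = E_ξ(x)·(𝖥𝖪f)(x)` for a.e. real `x` (`Φ/E = 𝖥f` a.e. by the cell's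
boundary-value theorem, `𝖥𝖪f = Θ·conj 𝖥f`, `Θ = E♯/E`, and `Φ♯ = conj Φ`, `E♯ = conj E` on `ℝ`).
RH-FREE. [cite: Suzuki2025WeilHilbertSpace, CJM Lemma 5.1 proof p. 13 (TeX l.1474–1482) and Thm. 5.7 proof p. 16 (TeX l.1866–1870)] -/
theorem sharp_ofReal_ae_eq {Φ : ℂ → ℂ} {f : Lp ℂ 2 (volume : Measure ℝ)}
    (hΦd : Differentiable ℂ Φ) (hf : f ∈ suzukiV 0)
    (hΦ : ∀ z : ℂ, 0 < z.im → Φ z = lagariasE z * upperHalfHat f z) :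
    (fun x : ℝ ↦ sharp Φ x) =ᵐ[volume]
      fun x : ℝ ↦ lagariasE x * (suzukiFourierL2 (suzukiK f) : ℝ → ℂ) x := by
  have hfL : f ∈ halfLineL2 0 := (mem_suzukiV_iff.1 hf).1
  have h1 := div_lagariasE_ae_eq_suzukiFourierL2 hfL (fun x ↦ hΦd.continuous.continuousAt) hΦ
  filter_upwards [h1, suzukiFourierL2_suzukiK_ae_eq f, ae_lagariasE_ofReal_ne_zero] with x e1 e2 hE
  have hΦx : Φ x = lagariasE x * (suzukiFourierL2 f : ℝ → ℂ) x := by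
    rw [← e1, mul_div_cancel₀ _ hE]
  rw [e2, sharp_ofReal, hΦx, map_mul, ← mul_assoc]
  congr 1
  rw [lagariasTheta, mul_div_cancel₀ _ hE, sharp_ofReal]

/-! ## B. RH-FREE bounds on `ℂ₊` -/

/-- `‖e_w‖² = 1/(2 Im w)` for the Cauchy vector (`⟪e_w, e_w⟫ = ê_w(w) = i/(w − w̄)`). RH-FREE.
[cite: Suzuki2025WeilHilbertSpace, CJM §2.3 p. 5 (TeX l.615–619)] -/
theorem norm_sq_cauchyVec {w : ℂ} (hw : 0 < w.im) : ‖cauchyVec w‖ ^ 2 = 1 / (2 * w.im) := by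
  have h := inner_cauchyVec hw (cauchyVec w)
  rw [upperHalfHat_cauchyVec hw hw.le, Complex.sub_conj] at h
  have him : (w.im : ℂ) ≠ 0 := Complex.ofReal_ne_zero.2 hw.ne'
  have h2 : I / (((2 * w.im : ℝ) : ℂ) * I) = ((1 / (2 * w.im) : ℝ) : ℂ) := by
    push_cast
    field_simp
  rw [← inner_self_eq_norm_sq (𝕜 := ℂ) (cauchyVec w), h, h2]
  simp only [RCLike.re_to_complex, Complex.ofReal_re]

/-- **`|ĝ(z)| ≤ ‖g‖/√(2 Im z)`** for every `g ∈ L²(ℝ)` and `Im z > 0` (Cauchy–Schwarz against the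
Cauchy vector: `ĝ(z) = ⟪e_z, g⟫`, `‖e_z‖² = 1/(2 Im z)`). RH-FREE.
[cite: Suzuki2025WeilHilbertSpace, CJM §2.3 p. 5 (TeX l.615–619: "H² = 𝖥(L²(0,∞))")] -/
theorem norm_upperHalfHat_le (g : Lp ℂ 2 (volume : Measure ℝ)) {z : ℂ} (hz : 0 < z.im) :
    ‖upperHalfHat g z‖ ≤ ‖g‖ / Real.sqrt (2 * z.im) := by
  rw [← inner_cauchyVec hz g]
  have h1 : ‖cauchyVec z‖ = 1 / Real.sqrt (2 * z.im) := by
    have h := norm_sq_cauchyVec hz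
    have h0 : (0 : ℝ) ≤ ‖cauchyVec z‖ := norm_nonneg _
    rw [← Real.sqrt_sq h0, h, Real.sqrt_div' _ (by linarith), Real.sqrt_one]
  calc ‖inner ℂ (cauchyVec z) g‖ ≤ ‖cauchyVec z‖ * ‖g‖ := norm_inner_le_norm _ _
    _ = ‖g‖ / Real.sqrt (2 * z.im) := by rw [h1]; ring

/-- `|ĝ(x+iy)| ≤ ‖g‖·y^{−1/2}` (`0 < y`; the previous bound with `1/√(2y) ≤ y^{−1/2}`). RH-FREE.
[cite: Suzuki2025WeilHilbertSpace, CJM §2.3 p. 5 (TeX l.615–619)] -/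
theorem norm_upperHalfHat_le_rpow (g : Lp ℂ 2 (volume : Measure ℝ)) {z : ℂ} (hz : 0 < z.im) :
    ‖upperHalfHat g z‖ ≤ ‖g‖ * z.im ^ (-(1 / 2 : ℝ)) := by
  refine (norm_upperHalfHat_le g hz).trans ?_
  rw [div_eq_mul_inv]
  refine mul_le_mul_of_nonneg_left ?_ (norm_nonneg _)
  rw [Real.rpow_neg hz.le, ← Real.sqrt_eq_rpow]
  refine inv_anti₀ (Real.sqrt_pos.2 hz) (Real.sqrt_le_sqrt (by linarith))

/-! ## C. Two pieces of real-variable plumbing -/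

/-- Uniform continuity of a continuous `F : ℂ → ℂ` on the box `[a,b] × [0,1]`: `F(x+iy) → F(x)`
uniformly in `x ∈ [a,b]` as `y ↓ 0`, in `ε`–`δ` form. [folklore] -/
private theorem exists_forall_norm_sub_lt_of_continuous {F : ℂ → ℂ} (hF : Continuous F) (a b : ℝ)
    {ε : ℝ} (hε : 0 < ε) :
    ∃ δ > 0, ∀ x ∈ Icc a b, ∀ y : ℝ, 0 < y → y < δ → ‖F (x + y * I) - F x‖ < ε := by
  have hK : IsCompact (Icc a b ×ℂ Icc (0 : ℝ) 1) := isCompact_Icc.reProdIm isCompact_Icc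
  obtain ⟨δ, hδ, h⟩ := Metric.uniformContinuousOn_iff.1
    (hK.uniformContinuousOn_of_continuous hF.continuousOn) ε hε
  refine ⟨min δ 1, lt_min hδ one_pos, fun x hx y hy hyδ ↦ ?_⟩
  have hy1 : y ≤ 1 := (hyδ.le.trans (min_le_right _ _))
  have hm1 : ((x : ℂ) + y * I) ∈ Icc a b ×ℂ Icc (0 : ℝ) 1 := by
    refine ⟨?_, ?_⟩ <;> simp [hx.1, hx.2, hy.le, hy1]
  have hm2 : (x : ℂ) ∈ Icc a b ×ℂ Icc (0 : ℝ) 1 := by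
    refine ⟨?_, ?_⟩ <;> simp [hx.1, hx.2]
  have hd : dist ((x : ℂ) + y * I) (x : ℂ) < δ := by
    rw [dist_eq_norm, add_sub_cancel_left, norm_mul, Complex.norm_I, mul_one, Complex.norm_real,
      Real.norm_eq_abs, abs_of_pos hy]
    exact hyδ.trans_le (min_le_left _ _)
  have := h _ hm1 _ hm2 hd
  rwa [dist_eq_norm] at this

/-- **`L²(ℝ)`-classes are locally `L¹`, with Cauchy–Schwarz**: for `F ∈ L²(ℝ)` and `a ≤ b`,
`∫_a^b |F| ≤ √(b − a)·‖F‖_{L²(ℝ)}`. [folklore] -/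
private theorem setIntegral_norm_le_sqrt_mul_norm (F : Lp ℂ 2 (volume : Measure ℝ)) {a b : ℝ}
    (hab : a ≤ b) : ∫ x in Ioc a b, ‖(F : ℝ → ℂ) x‖ ≤ Real.sqrt (b - a) * ‖F‖ := by
  set μ' : Measure ℝ := volume.restrict (Ioc a b) with hμ'
  have hF2 : MemLp (fun x ↦ ‖(F : ℝ → ℂ) x‖) (ENNReal.ofReal 2) μ' := by
    have h := ((Lp.memLp F).restrict (Ioc a b)).norm
    simpa using h
  have h1 : MemLp (fun _ : ℝ ↦ (1 : ℝ)) (ENNReal.ofReal 2) μ' := memLp_const 1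
  have hH := integral_mul_le_Lp_mul_Lq_of_nonneg (μ := μ') Real.HolderConjugate.two_two
    (ae_of_all _ fun x ↦ norm_nonneg ((F : ℝ → ℂ) x)) (ae_of_all _ fun _ ↦ zero_le_one) hF2 h1
  simp only [mul_one, Real.rpow_two, one_pow, integral_const, smul_eq_mul] at hH
  rw [← Real.sqrt_eq_rpow, ← Real.sqrt_eq_rpow] at hH
  have hvol : μ'.real univ = b - a := by
    rw [hμ', measureReal_restrict_apply_univ, Real.volume_real_Ioc_of_le hab]
  rw [hvol] at hH
  refine hH.trans ?_
  rw [mul_comm]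
  refine mul_le_mul_of_nonneg_left ?_ (Real.sqrt_nonneg _)
  -- `√(∫_{(a,b]} |F|²) ≤ √(∫_ℝ |F|²) = ‖F‖`
  have hi : Integrable (fun x ↦ ‖(F : ℝ → ℂ) x‖ ^ 2) volume := integrable_sq_norm_Lp F
  have hle : ∫ x, ‖(F : ℝ → ℂ) x‖ ^ 2 ∂μ' ≤ ∫ x, ‖(F : ℝ → ℂ) x‖ ^ 2 :=
    setIntegral_le_integral hi (ae_of_all _ fun x ↦ by positivity)
  calc Real.sqrt (∫ x, ‖(F : ℝ → ℂ) x‖ ^ 2 ∂μ') ≤ Real.sqrt (∫ x, ‖(F : ℝ → ℂ) x‖ ^ 2) :=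
        Real.sqrt_le_sqrt hle
    _ = ‖F‖ := by rw [← norm_sq_eq_integral_Lp_two, Real.sqrt_sq (norm_nonneg _)]

/-- An `L²(ℝ)`-class is integrable on every bounded interval. [folklore] -/
private theorem integrableOn_Ioc (F : Lp ℂ 2 (volume : Measure ℝ)) (a b : ℝ) :
    IntegrableOn (F : ℝ → ℂ) (Ioc a b) volume :=
  ((Lp.memLp F).restrict (Ioc a b)).integrable one_le_two

/-! ## D. `Φ♯ = E_ξ·(𝖪f)^` on `ℂ₊` — boundary uniqueness for the defect `Φ♯ − E_ξ·(𝖪f)^` -/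

variable {Φ : ℂ → ℂ} {f : Lp ℂ 2 (volume : Measure ℝ)}

/-- The defect `z ↦ Φ♯(z) − E_ξ(z)ĝ(z)` is holomorphic on `ℂ₊` for entire `Φ` and any `g ∈ L²(ℝ)`.
[cite: Suzuki2025WeilHilbertSpace, CJM Thm. 5.7 proof p. 16 (TeX l.1858–1870)] -/
theorem differentiableOn_defect (hΦd : Differentiable ℂ Φ) (g : Lp ℂ 2 (volume : Measure ℝ)) :
    DifferentiableOn ℂ (fun z : ℂ ↦ sharp Φ z - lagariasE z * upperHalfHat g z)
      {z : ℂ | 0 < z.im} :=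
  (differentiable_sharp hΦd).differentiableOn.sub (differentiableOn_lagariasE_mul_upperHalfHat g)

/-- The defect is majorised by `C(1 + y^{−1/2})` on every box `[a,b] × (0,Y]` (`Φ♯`, `E_ξ` are
bounded on the compact box and `|ĝ(x+iy)| ≤ ‖g‖y^{−1/2}`).
[cite: Suzuki2025WeilHilbertSpace, CJM §2.3 p. 5 and Thm. 5.7 proof p. 16] -/
theorem defect_majorant (hΦd : Differentiable ℂ Φ) (g : Lp ℂ 2 (volume : Measure ℝ)) (a b Y : ℝ) :
    ∃ C : ℝ, ∀ x ∈ Icc a b, ∀ y : ℝ, 0 < y → y ≤ Y →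
      ‖sharp Φ (x + y * I) - lagariasE (x + y * I) * upperHalfHat g (x + y * I)‖ ≤
        C * (1 + y ^ (-(1 / 2 : ℝ))) := by
  have hK : IsCompact (Icc a b ×ℂ Icc (0 : ℝ) Y) := isCompact_Icc.reProdIm isCompact_Icc
  obtain ⟨M₁, hM₁⟩ := hK.exists_bound_of_continuousOn
    (differentiable_sharp hΦd).continuous.continuousOn
  obtain ⟨M₂, hM₂⟩ := hK.exists_bound_of_continuousOn continuous_lagariasE.continuousOn
  refine ⟨max M₁ (M₂ * ‖g‖), fun x hx y hy hyY ↦ ?_⟩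
  have hmem : ((x : ℂ) + y * I) ∈ Icc a b ×ℂ Icc (0 : ℝ) Y := by
    refine ⟨?_, ?_⟩ <;> simp [hx.1, hx.2, hy.le, hyY]
  have hz : 0 < ((x : ℂ) + y * I).im := by simpa using hy
  have h1 := hM₁ _ hmem
  have h2 := hM₂ _ hmem
  have h3 := norm_upperHalfHat_le_rpow g hz
  have hyim : ((x : ℂ) + y * I).im = y := by simp
  rw [hyim] at h3
  have hr : 0 ≤ y ^ (-(1 / 2 : ℝ)) := Real.rpow_nonneg hy.le _
  have hM₂0 : 0 ≤ M₂ := (norm_nonneg _).trans h2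
  calc ‖sharp Φ (x + y * I) - lagariasE (x + y * I) * upperHalfHat g (x + y * I)‖
      ≤ ‖sharp Φ (x + y * I)‖ + ‖lagariasE (x + y * I)‖ * ‖upperHalfHat g (x + y * I)‖ := by
        refine (norm_sub_le _ _).trans ?_
        rw [norm_mul]
    _ ≤ M₁ + M₂ * (‖g‖ * y ^ (-(1 / 2 : ℝ))) := by gcongr
    _ ≤ max M₁ (M₂ * ‖g‖) * 1 + max M₁ (M₂ * ‖g‖) * y ^ (-(1 / 2 : ℝ)) := by
        refine add_le_add ?_ ?_
        · rw [mul_one]; exact le_max_left _ _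
        · rw [← mul_assoc]; exact mul_le_mul_of_nonneg_right (le_max_right _ _) hr
    _ = max M₁ (M₂ * ‖g‖) * (1 + y ^ (-(1 / 2 : ℝ))) := by ring

/-- **The traces of the defect `Φ♯ − E_ξ·(𝖪f)^` tend to zero in `L¹_loc`** (`f ∈ V(0)`, `Φ` entire
with `Φ = E_ξf̂` on `ℂ₊`): on `[a,b]`, `Φ♯(x+iy) → Φ♯(x)` uniformly, `E_ξ(x+iy) → E_ξ(x)` uniformly,
`(𝖪f)^(·+iy) → 𝖥𝖪f` in `L²(ℝ)` (the cell's boundary-value theorem), and `Φ♯ = E_ξ·𝖥𝖪f` a.e.;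
`ε`–`δ` form for `a ≤ b`. RH-FREE.
[cite: Suzuki2025WeilHilbertSpace, CJM Lemma 5.1 proof p. 13 (TeX l.1474–1482) and Thm. 5.7 proof p. 16 (TeX l.1858–1870)] -/
theorem defect_setIntegral_lt (hΦd : Differentiable ℂ Φ) (hf : f ∈ suzukiV 0)
    (hΦ : ∀ z : ℂ, 0 < z.im → Φ z = lagariasE z * upperHalfHat f z) {a b : ℝ} (hab : a ≤ b)
    {ε : ℝ} (hε : 0 < ε) :
    ∃ δ > 0, ∀ y : ℝ, 0 < y → y < δ →
      ∫ x in Ioc a b, ‖sharp Φ (x + y * I) -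
        lagariasE (x + y * I) * upperHalfHat (suzukiK f) (x + y * I)‖ < ε := by
  have hg : suzukiK f ∈ suzukiV 0 := suzukiK_mem_suzukiV hf
  have hgL : suzukiK f ∈ halfLineL2 0 := (mem_suzukiV_iff.1 hg).1
  -- `|E_ξ| ≤ M` on `[a,b]`
  obtain ⟨M, hM⟩ := isCompact_Icc.exists_bound_of_continuousOn (s := Icc a b)
    (f := fun x : ℝ ↦ lagariasE x) (continuous_lagariasE.comp continuous_ofReal).continuousOn
  have hM' : ∀ x ∈ Icc a b, ‖lagariasE (x : ℂ)‖ ≤ M := hM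
  have hM0 : 0 ≤ M := (norm_nonneg _).trans (hM' a (left_mem_Icc.2 hab))
  set L : ℝ := Real.sqrt (b - a) with hL
  have hL0 : 0 ≤ L := Real.sqrt_nonneg _
  set N : ℝ := ‖suzukiFourierL2 (suzukiK f)‖ with hN
  have hN0 : 0 ≤ N := norm_nonneg _
  -- the three `ε`-pieces
  obtain ⟨ε₁, hε₁, hε₁b⟩ : ∃ ε₁ : ℝ, 0 < ε₁ ∧ ε₁ * (b - a) ≤ ε / 4 := by
    refine ⟨ε / (4 * (b - a + 1)), by positivity, ?_⟩
    rw [div_mul_eq_mul_div, div_le_div_iff₀ (by positivity) (by norm_num)]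
    nlinarith
  obtain ⟨ε₂, hε₂, hε₂1, hε₂b⟩ : ∃ ε₂ : ℝ, 0 < ε₂ ∧ ε₂ ≤ 1 ∧ ε₂ * (L * N) ≤ ε / 4 := by
    refine ⟨min 1 (ε / (4 * (L * N + 1))), by positivity, min_le_left _ _, ?_⟩
    calc min 1 (ε / (4 * (L * N + 1))) * (L * N) ≤ ε / (4 * (L * N + 1)) * (L * N) :=
          mul_le_mul_of_nonneg_right (min_le_right _ _) (by positivity)
      _ ≤ ε / 4 := by
          rw [div_mul_eq_mul_div, div_le_div_iff₀ (by positivity) (by norm_num)]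
          nlinarith [mul_nonneg hL0 hN0]
  obtain ⟨ε₃, hε₃, hε₃b⟩ : ∃ ε₃ : ℝ, 0 < ε₃ ∧ (M + 1) * (L * ε₃) ≤ ε / 4 := by
    refine ⟨ε / (4 * ((M + 1) * (L + 1))), by positivity, ?_⟩
    calc (M + 1) * (L * (ε / (4 * ((M + 1) * (L + 1)))))
        ≤ (M + 1) * ((L + 1) * (ε / (4 * ((M + 1) * (L + 1))))) := by gcongr; linarith
      _ = ε / 4 := by field_simp
  -- the three `δ`'s
  obtain ⟨δ₁, hδ₁, h₁⟩ :=
    exists_forall_norm_sub_lt_of_continuous (differentiable_sharp hΦd).continuous a b hε₁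
  obtain ⟨δ₂, hδ₂, h₂⟩ := exists_forall_norm_sub_lt_of_continuous continuous_lagariasE a b hε₂
  obtain ⟨δ₃, hδ₃, h₃⟩ := norm_suzukiFourierL2_indicator_mul_exp_sub_lt hgL hε₃
  refine ⟨min δ₁ (min δ₂ δ₃), by positivity, fun y hy hyδ ↦ ?_⟩
  have hy₁ : y < δ₁ := hyδ.trans_le (min_le_left _ _)
  have hy₂ : y < δ₂ := hyδ.trans_le ((min_le_right _ _).trans (min_le_left _ _))
  have hy₃ : y < δ₃ := hyδ.trans_le ((min_le_right _ _).trans (min_le_right _ _))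
  -- the `L²` class `W = 𝖥[(𝖪f)e^{−y·}] − 𝖥𝖪f`, represented by `x ↦ (𝖪f)^(x+iy) − (𝖥𝖪f)(x)`
  set W : Lp ℂ 2 (volume : Measure ℝ) :=
    suzukiFourierL2 ((memLp_two_indicator_mul_exp (suzukiK f) hy.le).toLp _) -
      suzukiFourierL2 (suzukiK f) with hW
  have hWn : ‖W‖ < ε₃ := h₃ y hy hy₃
  set G : ℝ → ℂ := (suzukiFourierL2 (suzukiK f) : ℝ → ℂ) with hG
  have hWae : (W : ℝ → ℂ) =ᵐ[volume]
      fun x : ℝ ↦ upperHalfHat (suzukiK f) (x + y * I) - G x := by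
    filter_upwards [Lp.coeFn_sub
      (suzukiFourierL2 ((memLp_two_indicator_mul_exp (suzukiK f) hy.le).toLp _))
      (suzukiFourierL2 (suzukiK f)),
      suzukiFourierL2_indicator_mul_exp_ae_eq (suzukiK f) hy] with x e1 e2
    have e : (x : ℂ) + I * y = x + y * I := by ring
    rw [e] at e2
    rw [hW, e1, Pi.sub_apply, e2]
  -- the a.e. pointwise bound on `(a,b]`
  have hkey := sharp_ofReal_ae_eq hΦd hf hΦ
  have hbound : ∀ᵐ x : ℝ ∂(volume.restrict (Ioc a b)),
      ‖sharp Φ (x + y * I) - lagariasE (x + y * I) * upperHalfHat (suzukiK f) (x + y * I)‖ ≤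
        ε₁ + ε₂ * ‖G x‖ + (M + ε₂) * ‖(W : ℝ → ℂ) x‖ := by
    rw [ae_restrict_iff' measurableSet_Ioc]
    filter_upwards [hkey, hWae] with x hx hWx hxab
    have hxI : x ∈ Icc a b := Ioc_subset_Icc_self hxab
    have hT1 := (h₁ x hxI y hy hy₁).le
    have hT2 : ‖lagariasE (x : ℂ) - lagariasE (x + y * I)‖ ≤ ε₂ := by
      rw [norm_sub_rev]; exact (h₂ x hxI y hy hy₂).le
    have hEx := hM' x hxI
    have hĝ : upperHalfHat (suzukiK f) (x + y * I) = G x + (W : ℝ → ℂ) x := by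
      rw [hWx]; ring
    have heq : sharp Φ (x + y * I) - lagariasE (x + y * I) * upperHalfHat (suzukiK f) (x + y * I)
        = (sharp Φ (x + y * I) - sharp Φ x) - lagariasE x * (W : ℝ → ℂ) x +
          (lagariasE x - lagariasE (x + y * I)) * (G x + (W : ℝ → ℂ) x) := by
      rw [hĝ, hx]; ring
    rw [heq]
    calc ‖(sharp Φ (x + y * I) - sharp Φ x) - lagariasE x * (W : ℝ → ℂ) x +
          (lagariasE x - lagariasE (x + y * I)) * (G x + (W : ℝ → ℂ) x)‖
        ≤ ‖sharp Φ (x + y * I) - sharp Φ x‖ + ‖lagariasE x‖ * ‖(W : ℝ → ℂ) x‖ +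
          ‖lagariasE x - lagariasE (x + y * I)‖ * (‖G x‖ + ‖(W : ℝ → ℂ) x‖) := by
          refine (norm_add_le _ _).trans (add_le_add ((norm_sub_le _ _).trans ?_) ?_)
          · rw [norm_mul]
          · rw [norm_mul]; gcongr; exact norm_add_le _ _
      _ ≤ ε₁ + M * ‖(W : ℝ → ℂ) x‖ + ε₂ * (‖G x‖ + ‖(W : ℝ → ℂ) x‖) := by gcongr
      _ = ε₁ + ε₂ * ‖G x‖ + (M + ε₂) * ‖(W : ℝ → ℂ) x‖ := by ring
  -- integrability on `(a,b]`
  have hcont : Continuous fun x : ℝ ↦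
      sharp Φ (x + y * I) - lagariasE (x + y * I) * upperHalfHat (suzukiK f) (x + y * I) := by
    have hline : Continuous fun x : ℝ ↦ (x : ℂ) + y * I := by fun_prop
    have hmem : ∀ x : ℝ, ((x : ℂ) + y * I) ∈ {z : ℂ | 0 < z.im} := fun x ↦ by
      show 0 < ((x : ℂ) + y * I).im
      simpa using hy
    exact (differentiableOn_defect hΦd (suzukiK f)).continuousOn.comp_continuous hline hmem
  have hDint : IntegrableOn (fun x : ℝ ↦
      ‖sharp Φ (x + y * I) - lagariasE (x + y * I) * upperHalfHat (suzukiK f) (x + y * I)‖)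
      (Ioc a b) volume :=
    (hcont.norm.integrableOn_Icc (a := a) (b := b)).mono_set Ioc_subset_Icc_self
  have hGint : IntegrableOn (fun x : ℝ ↦ ‖G x‖) (Ioc a b) volume :=
    (integrableOn_Ioc (suzukiFourierL2 (suzukiK f)) a b).norm
  have hWint : IntegrableOn (fun x : ℝ ↦ ‖(W : ℝ → ℂ) x‖) (Ioc a b) volume :=
    (integrableOn_Ioc W a b).norm
  have hcint : IntegrableOn (fun _ : ℝ ↦ ε₁) (Ioc a b) volume := by
    rw [IntegrableOn]; exact integrable_const ε₁
  have hGint' : IntegrableOn (fun x : ℝ ↦ ε₂ * ‖G x‖) (Ioc a b) volume := hGint.const_mul ε₂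
  have hWint' : IntegrableOn (fun x : ℝ ↦ (M + ε₂) * ‖(W : ℝ → ℂ) x‖) (Ioc a b) volume :=
    hWint.const_mul (M + ε₂)
  have h12 : IntegrableOn (fun x : ℝ ↦ ε₁ + ε₂ * ‖G x‖) (Ioc a b) volume := hcint.add hGint'
  have hRint : IntegrableOn (fun x : ℝ ↦ ε₁ + ε₂ * ‖G x‖ + (M + ε₂) * ‖(W : ℝ → ℂ) x‖)
      (Ioc a b) volume := h12.add hWint'
  -- integrate the bound
  have hmono := integral_mono_ae hDint hRint hbound
  have hrhs : ∫ x in Ioc a b, (ε₁ + ε₂ * ‖G x‖ + (M + ε₂) * ‖(W : ℝ → ℂ) x‖) =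
      ε₁ * (b - a) + ε₂ * (∫ x in Ioc a b, ‖G x‖) +
        (M + ε₂) * ∫ x in Ioc a b, ‖(W : ℝ → ℂ) x‖ := by
    rw [integral_add h12 hWint', integral_add hcint hGint', integral_const_mul, integral_const_mul,
      setIntegral_const, Real.volume_real_Ioc_of_le hab, smul_eq_mul, mul_comm (b - a)]
  have hGle := setIntegral_norm_le_sqrt_mul_norm (suzukiFourierL2 (suzukiK f)) hab
  have hWle := setIntegral_norm_le_sqrt_mul_norm W hab
  rw [hrhs] at hmono
  refine hmono.trans_lt ?_
  have hMε : 0 ≤ M + ε₂ := by positivity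
  calc ε₁ * (b - a) + ε₂ * (∫ x in Ioc a b, ‖G x‖) + (M + ε₂) * ∫ x in Ioc a b, ‖(W : ℝ → ℂ) x‖
      ≤ ε / 4 + ε₂ * (L * N) + (M + ε₂) * (L * ‖W‖) := by
        refine add_le_add (add_le_add hε₁b ?_) ?_
        · exact mul_le_mul_of_nonneg_left hGle hε₂.le
        · exact mul_le_mul_of_nonneg_left hWle hMε
    _ ≤ ε / 4 + ε / 4 + (M + 1) * (L * ε₃) := by
        refine add_le_add (add_le_add le_rfl hε₂b) ?_
        exact mul_le_mul (by linarith) (mul_le_mul_of_nonneg_left hWn.le hL0)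
          (by positivity) (by positivity)
    _ ≤ ε / 4 + ε / 4 + ε / 4 := by linarith
    _ < ε := by linarith

/-- **The traces of the defect tend to zero in `L¹_loc`**, in the form consumed by the boundary
uniqueness theorem `DeBrangesSpaces.eq_zero_of_trace_tendsto_zero` (all `a, b`). RH-FREE.
[cite: Suzuki2025WeilHilbertSpace, CJM Thm. 5.7 proof p. 16 (TeX l.1858–1870)] -/
theorem defect_trace_tendsto_zero (hΦd : Differentiable ℂ Φ) (hf : f ∈ suzukiV 0)
    (hΦ : ∀ z : ℂ, 0 < z.im → Φ z = lagariasE z * upperHalfHat f z) (a b : ℝ) :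
    Tendsto (fun y : ℝ ↦ ∫ x in a..b, ‖sharp Φ (x + y * I) -
        lagariasE (x + y * I) * upperHalfHat (suzukiK f) (x + y * I)‖) (𝓝[>] 0) (𝓝 0) := by
  rw [Metric.tendsto_nhdsWithin_nhds]
  intro ε hε
  obtain ⟨δ, hδ, h⟩ := defect_setIntegral_lt hΦd hf hΦ (min_le_max : min a b ≤ max a b) hε
  refine ⟨δ, hδ, fun {y} hy hyδ ↦ ?_⟩
  have hy' : 0 < y := hy
  rw [dist_zero_right, Real.norm_eq_abs, abs_of_pos hy'] at hyδ
  rw [dist_zero_right]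
  refine (intervalIntegral.norm_integral_le_integral_norm_uIoc).trans_lt ?_
  simp only [norm_norm]
  exact h y hy' hyδ

/-- **The gluing identity `Φ♯ = E_ξ·(𝖪f)^` on `ℂ₊`** for every entire `Φ` with `Φ = E_ξf̂` on `ℂ₊`,
`f ∈ V(0)` — equivalently `Φ(z) = E_ξ♯(z)·conj((𝖪f)^(z̄))` on the LOWER half-plane: the printed
"`(𝖥𝖪ψ)(z) = Θ(z)(𝖥ψ)♯(z)`", read off the real line into the half-planes by boundary uniqueness
(`DeBrangesSpaces.eq_zero_of_trace_tendsto_zero`). RH-FREE.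
[cite: Suzuki2025WeilHilbertSpace, CJM Lemma 5.1 proof p. 13 (TeX l.1474–1482) and Thm. 5.7 proof p. 16 (TeX l.1858–1870: "Φ♯ = E·(𝖪ψ)^ … (dB2)")] -/
theorem sharp_eq_lagariasE_mul_upperHalfHat_suzukiK (hΦd : Differentiable ℂ Φ) (hf : f ∈ suzukiV 0)
    (hΦ : ∀ z : ℂ, 0 < z.im → Φ z = lagariasE z * upperHalfHat f z) {z : ℂ} (hz : 0 < z.im) :
    sharp Φ z = lagariasE z * upperHalfHat (suzukiK f) z := by
  have h := eq_zero_of_trace_tendsto_zero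
    (D := fun z : ℂ ↦ sharp Φ z - lagariasE z * upperHalfHat (suzukiK f) z)
    (differentiableOn_defect hΦd (suzukiK f)) (defect_majorant hΦd (suzukiK f))
    (defect_trace_tendsto_zero hΦd hf hΦ) hz
  exact sub_eq_zero.1 h

/-! ## E. Consequences: (dB2) for the chain, the kernel bound on both half-planes, `𝓗(E_ξ) = E_ξ𝖥(V(0))` -/

/-- **Axiom (dB2) for the chain spaces, RH-FREE**: for `t ≥ 0`, `Φ ∈ E_ξ𝖥(V(t))` implies
`Φ♯ ∈ E_ξ𝖥(V(t))`, with witness `𝖪f ∈ V(t)` (`V(t)` is `𝖪`-invariant) — CJM Thm. 5.7's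
"`Φ♯ = E·(𝖪ψ)^` … hence (dB2)", here without the RH binder.
[cite: Suzuki2025WeilHilbertSpace, CJM Thm. 5.7 proof p. 16 (TeX l.1858–1870)] -/
theorem sharp_mem_suzukiChainSpace {t : ℝ} (ht : 0 ≤ t) (hΦ : Φ ∈ suzukiChainSpace t) :
    sharp Φ ∈ suzukiChainSpace t := by
  obtain ⟨hΦd, f, hf, hΦf⟩ := hΦ
  have hf0 : f ∈ suzukiV 0 := suzukiV_antitone ht hf
  exact ⟨differentiable_sharp hΦd, suzukiK f, suzukiK_mem_suzukiV hf,
    fun z hz ↦ sharp_eq_lagariasE_mul_upperHalfHat_suzukiK hΦd hf0 hΦf hz⟩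

/-- **The reproducing-kernel inequality on BOTH half-planes (under RH)**: for `Φ` entire with
`Φ = E_ξf̂` on `ℂ₊`, `f ∈ V(0)`, and every non-real `z`, `|Φ(z)|² ≤ 2π‖f‖²·K(z,z)` — on `ℂ₊` the
cell's `norm_sq_lagariasE_mul_upperHalfHat_le`, on `ℂ₋` through the gluing `Φ(z) = conj(Φ♯(z̄))`,
`Φ♯ = E_ξ(𝖪f)^`, `‖𝖪f‖ = ‖f‖` and `K(z̄,z̄) = K(z,z)`. RH-CONSEQUENCE (Conrey–Li (2.1) / de Branges'
axiom for `E_ξψ̂`). [cite: Suzuki2025WeilHilbertSpace, CJM §2.2 eq. (2.4)–(2.6) p. 4 and Lemma 5.1 p. 13] -/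
theorem norm_sq_le_kernelDiag (hRH : RiemannHypothesis) (hΦd : Differentiable ℂ Φ)
    (hf : f ∈ suzukiV 0) (hΦf : ∀ z : ℂ, 0 < z.im → Φ z = lagariasE z * upperHalfHat f z)
    {z : ℂ} (hz : z.im ≠ 0) :
    ‖Φ z‖ ^ 2 ≤ 2 * π * ‖f‖ ^ 2 * deBrangesKernelDiag lagariasE z := by
  rcases lt_or_gt_of_ne hz with hneg | hpos
  · have hzc : 0 < (conj z).im := by rw [Complex.conj_im]; linarith
    have h1 : Φ z = conj (sharp Φ (conj z)) := by simp [sharp]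
    have h2 := sharp_eq_lagariasE_mul_upperHalfHat_suzukiK hΦd hf hΦf hzc
    have h3 := SuzukiKernelBound.norm_sq_lagariasE_mul_upperHalfHat_le hRH
      (suzukiK_mem_suzukiV hf) hzc
    rw [h1, Complex.norm_conj, h2, ← deBrangesKernelDiag_conj lagariasE z, ← norm_suzukiK f]
    exact h3
  · rw [hΦf z hpos]
    exact SuzukiKernelBound.norm_sq_lagariasE_mul_upperHalfHat_le hRH hf hpos

/-- `Φ/E_ξ ∈ L²(ℝ)` for `Φ = E_ξf̂` on `ℂ₊`, `f ∈ V(0)`, `Φ` entire (`Φ/E_ξ = 𝖥f` a.e.). RH-FREE.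
[cite: Suzuki2025WeilHilbertSpace, CJM Lemma 5.1 p. 13 and eq. (2.4) p. 4] -/
theorem memLp_div_lagariasE (hΦd : Differentiable ℂ Φ) (hf : f ∈ suzukiV 0)
    (hΦf : ∀ z : ℂ, 0 < z.im → Φ z = lagariasE z * upperHalfHat f z) :
    MemLp (fun x : ℝ ↦ Φ x / lagariasE x) 2 volume :=
  (Lp.memLp (suzukiFourierL2 f)).ae_eq (div_lagariasE_ae_eq_suzukiFourierL2
    (mem_suzukiV_iff.1 hf).1 (fun _ ↦ hΦd.continuous.continuousAt) hΦf).symm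

/-- **`E_ξ𝖥(V(0)) ⊆ 𝓗(E_ξ)` under RH, membership form**: every `Φ ∈ suzukiChainSpace 0` lies in the
de Branges space `DeBrangesSpace lagariasE` (pointwise characterization: entire, `Φ/E ∈ L²(ℝ)`,
`|Φ(z)|² ≤ C·K(z,z)` off `ℝ`, here with `C = 2π‖f‖² = ‖Φ/E‖²_{L²}`). RH-CONSEQUENCE.
[cite: Suzuki2025WeilHilbertSpace, CJM Lemma 5.1 p. 13 (TeX l.1464–1496) (= arXiv v1 Thm. 1.2 (1))] -/
theorem mem_deBrangesSpace_of_mem_suzukiChainSpace_zero (hRH : RiemannHypothesis)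
    (hΦ : Φ ∈ suzukiChainSpace 0) : Φ ∈ DeBrangesSpace lagariasE := by
  obtain ⟨hΦd, f, hf, hΦf⟩ := hΦ
  exact DeBrangesSpace.mem_iff.2 ⟨hΦd, memLp_div_lagariasE hΦd hf hΦf, 2 * π * ‖f‖ ^ 2,
    fun z hz ↦ norm_sq_le_kernelDiag hRH hΦd hf hΦf hz⟩

end SuzukiChainInclusion

open SuzukiChainInclusion in
/-- **CJM Lemma 5.1 (ii), the inclusion `E_ξ𝖥(V(0)) ⊆ 𝓗(E_ξ)`, under RH.** RH-CONSEQUENCE, PROVED.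
[cite: Suzuki2025WeilHilbertSpace, CJM Lemma 5.1 p. 13 (TeX l.1464–1496) (= arXiv v1 Thm. 1.2 (1) p. 3)] -/
theorem suzukiChainSpace_zero_subset_deBrangesSpace (hRH : RiemannHypothesis) :
    suzukiChainSpace 0 ⊆ (DeBrangesSpace lagariasE : Set (ℂ → ℂ)) :=
  fun _ hΦ ↦ mem_deBrangesSpace_of_mem_suzukiChainSpace_zero hRH hΦ

/-- **CJM Lemma 5.1 (ii) under RH: `E_ξ𝖥(V(0)) = 𝓗(E_ξ)`** (this file's `⊆` and the cell's `⊇`,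
`deBrangesSpace_subset_suzukiChainSpace_zero`). RH-CONSEQUENCE, PROVED.
[cite: Suzuki2025WeilHilbertSpace, CJM Lemma 5.1 p. 13 (TeX l.1464–1496) (= arXiv v1 Thm. 1.2 (1) p. 3)] -/
theorem suzukiChainSpace_zero_eq_deBrangesSpace (hRH : RiemannHypothesis) :
    suzukiChainSpace 0 = (DeBrangesSpace lagariasE : Set (ℂ → ℂ)) :=
  (suzukiChainSpace_zero_subset_deBrangesSpace hRH).antisymm
    (deBrangesSpace_subset_suzukiChainSpace_zero hRH)

/-- **Discharge of the cell's RH-CONSEQUENCE fact `Suzuki2025_lemma51`** (CJM Lemma 5.1 = arXiv v1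
Thm. 1.2 (1): under RH, `𝓗(E_ξ) = E_ξ𝖥(V(0))`). The binder `RiemannHypothesis →` is the fact's own;
nothing here bears on the truth of RH.
[cite: Suzuki2025WeilHilbertSpace, CJM Lemma 5.1 p. 13 (TeX l.1464–1496) (= arXiv v1 Thm. 1.2 (1) p. 3)] -/
theorem Suzuki2025_lemma51_holds : Suzuki2025_lemma51 := fun hRH ↦
  suzukiChainSpace_zero_eq_deBrangesSpace hRH

end Literature.NumberTheory.LFunctions

end
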